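import Summits.BirchSwinnertonDyer.BirchSwinnertonDyer.Theorems.ResidualThetaTransportAtTwoSignedMuVanishingAtTwoPlusSel2
import HarnessLib

/-!
# Crux `SignedMuSeedAtTwoPlus` (stmt-BirchSwinnertonDyer-21438) — line `shadow-descent` (crux-ideate k2 g7)

IMMORTAL `Ш(W)[2]` AND SHADOW DESCENT (member `A := W`).

(1) FIXED-POINT PRESENTATION (stub_fixedPointPresentation, provable): for a habitat⁺ curve `W` the `Γ`-coinvariants
of the plus-Selmer dual mod `2` inject into the Pontryagin dual of `Sel₂(W/ℚ)`: `#X⁺(W)/(2,T)X⁺(W) ≤ #Sel₂(W/ℚ)`.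
Ingredients: `W(ℚ_∞)[2] = 0` (so `H¹(ℚ, W[2]) ≅ H¹(ℚ_∞, W[2])^Γ` and `H¹(ℚ_∞, W[2]) = H¹(ℚ_∞, W[2^∞])[2]`), and
∞-SATURATION of the local conditions pulled back to `ℚ`: at the unique prime over `2` the plus condition is member-free
(Honda type `T² + 2`, unique identification since `W[2]|_{G_{ℚ₂}}` has trivial centraliser) and residually injective up
the tower; at a multiplicative prime `ℓ` with `ord_ℓ Δ_W` odd the Kummer line is rigid (Mazur–Rubin 2010 Lemma 2.10(iii)
= Kramer Prop. 1–2) and DIES over `ℚ_{∞,η} = ℚ_ℓ^{ur,(2)}` (`W(ℚ_{∞,η}) ⊗ ℤ₂/2 = 0`); unramified classes at good primes die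
likewise.  Consequences recorded in the idea card: (a) `X⁺(W)` is generated by `dim Sel₂(W)` elements (= 2 on the 153
wall classes); (b) for an ∞-minimal `W` (all multiplicative primes of odd discriminant valuation, all additive primes
with `W[2]^{I_ℓ} = 0`) EVERY congruent good-supersingular `a₂ = 0` member `A` has `res(Ш(W)[2]) ⊂ Sel⁺(A/ℚ_∞)[2]`, so no
member is a unit anchor (`X⁺(A) = 0` is impossible; kit j306727: 0/838 reachable twists are anchors, `Sel₂` twist-rigid)
and the `∃ A` of the crux is not a resource for those classes: the seed must be proved for `W` itself.
(2) SHADOW DESCENT (stub_shadowDescent, the research stub): with `X⁺(W) ≅ Λ^d/(relations)`, `d = dim Sel₂(W)`, the seed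
`⟺` the `𝔽₂⟦T⟧`-module `X⁺/2` is torsion `⟺` no nonzero class of `Sel₂(W) = Ш(W)[2]` is infinitely `(γ-1)`-divisible in the
residual plus-Selmer tower `⟺` (Bertolini–Darmon–Howard derived filtration) every direction has a NONZERO 2-adic plus-SHADOW
at some layer; the layer-`n → n+1` obstruction is LOCAL AT THE SINGLE PRIME OVER 2 (Kramer's norm theorem in the quadratic
step `ℚ_{n+1}/ℚ_n`, all other places defect-free), e.g. rung 0: if the Kummer shadow `ℓ₂ : Ш(W)[2] → W(ℚ₂)/2W(ℚ₂) ≅ 𝔽₂` is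
nonzero then `rank_{𝔽₂⟦T⟧} X⁺/2 ≤ d - 1`.
Composition through the tree door `SignedMuAtTwo.signedMuSeedAtTwoPlus_of_sel2Seed` with `A := W`.  Sorries only in
`stub_*`.  BSD is not proved by this.
-/

noncomputable section

open scoped Classical

open WeierstrassCurve Literature.NumberTheory.EllipticCurves Literature.NumberTheory.EllipticCurves.Rank1Residual
  Literature.NumberTheory.EllipticCurves.Kobayashi2003
  Summit.BirchSwinnertonDyer.BirchSwinnertonDyer.Theses.ResidualThetaTransportAtTwo

namespace Summit.BirchSwinnertonDyer.BirchSwinnertonDyer.Cruxes.SignedMuSeedAtTwoPlus.ShadowDescent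

/-- **stub_fixedPointPresentation** (IMMORTAL `Ш[2]` / two-generator presentation; M–L sized, provable): on the habitat⁺
sub-row, for the cyclotomic `ℤ₂`-extension and any signed-Selmer dual data `D` (plus sign) with `X = D.X` finitely
generated, `#(X / 𝔪X) ≤ #Sel₂(W/ℚ) · 4^{#bad primes}` where `𝔪 = (2, T)` is the maximal ideal of `Λ = ℤ₂⟦T⟧` — i.e. `X⁺(W)` is
generated by `dim_{𝔽₂} Sel₂(W/ℚ) + 2·#\{ℓ ∣ N_W\}` elements (Nakayama); for an ∞-MINIMAL `W` (every multiplicative prime of odd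
discriminant valuation, every additive prime with `W[2]^{I_ℓ} = 0`) the sharp form is `#(X/𝔪X) = #Sel₂(W/ℚ)` (two generators on the
43–46 ∞-minimal wall classes); the factor `4` per bad prime bounds the ∞-relaxation `res_K^{-1}(L_η)/L_ℓ` at a stuck prime.  Proof sketch: `(X/𝔪X)^∨ = (Sel⁺(W/ℚ_∞)[2])^Γ`; inflation–restriction
(`W(ℚ_∞)[2] = 0`) identifies `H¹(ℚ_∞, W[2])^Γ` with `H¹(ℚ, W[2])`, and every local condition of the plus structure is
∞-saturated when pulled back to `ℚ_v` (plus condition at `2`: residual INJ⁺; `v`-odd multiplicative primes: Kramer /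
Mazur–Rubin rigidity; unramified classes die in `ℚ_ℓ^{ur,(2)}`), so the fixed part is cut out by the `Sel₂(W/ℚ)`
conditions. [cite: MazurRubin2010, Lemma 2.10(iii), Lemma 2.11] [cite: Kobayashi2003, Thm. 6.2, Prop. 8.12, Thm. 9.3]
[cite: GreenbergLNM1716, Lemma 3.2, Prop. 3.7] -/
theorem stub_fixedPointPresentation :
    ∀ (W : WeierstrassCurve ℚ) [W.IsElliptic] [W.IsGloballyMinimal], ¬ W.HasCM → W.analyticRank = 0 →
      GoodSS W 2 → W.frobeniusTrace 2 = 0 → W.Δ < 0 →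
      ∀ (κ : ZpExtension ℚ 2) (γ : Field.absoluteGaloisGroup ℚ), κ.IsCyclotomic → κ.IsTopGenerator γ →
      ∀ (D : SignedSelmerDualData W κ γ 1) [Module.Finite (IwasawaAlgebra 2) D.X],
        Nat.card (D.X ⧸ (IsLocalRing.maximalIdeal (IwasawaAlgebra 2)) • (⊤ : Submodule (IwasawaAlgebra 2) D.X)) ≤
          Nat.card (W.selmerGroup 2) * 4 ^ (W.conductorNorm ℤ).primeFactors.card := by
  sorry

/-- **stub_shadowDescent** (THE RESEARCH STUB — derived-shadow descent on the immortal classes): on the habitat⁺ sub-row,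
once `X⁺(W)` is presented on `d = dim Sel₂(W/ℚ)` generators (stub_fixedPointPresentation), the plus-Selmer `2`-torsion
`Sel⁺(W/ℚ_∞)[2]` is FINITE.  Mechanism: over the DVR `Ω = 𝔽₂⟦T⟧`, `X⁺/2 ≅ Ω^r ⊕ ⨁ Ω/T^{h_i+1}` with `r + #\{i\} = d`;
finiteness `⟺ r = 0 ⟺` no nonzero class of `Sel₂(W/ℚ)` (`= Ш(W)[2]` on the wall) is a universal norm of residual
plus-Selmer classes from every layer `ℚ_n`; the height of a direction jumps exactly when a 2-ADIC PLUS-SHADOW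
(the image of a layer-`n` lift in `E⁺(ℚ_{2,n})/(Tr E⁺(ℚ_{2,n+1}) + 2)`, a quotient determined by the member-free Honda
plus system) is nonzero — Kramer's norm theorem for the quadratic step `ℚ_{n+1}/ℚ_n` with its ONLY defect at the unique
prime over `2`.  Rung 0 (target of the first prover): `ℓ₂ ≠ 0` on `Ш(W)[2]` ⇒ `r ≤ d - 1`.  WHY IT MIGHT FAIL: the plus
structure is isotropic but not Lagrangian at finite layers, so the parity/evenness half of Kramer's theorem needs a
sandwich between the plus and Kummer structures; and a direction all of whose shadows vanish is exactly a `μ = 1`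
phenomenon, which this stub asserts never happens on the habitat. [cite: Kramer1981, Thm. 1, Prop. 3]
[cite: BertoliniDarmon1995, §2 (derived heights)] [cite: Howard2004, Thm. A] [cite: Kobayashi2003, Thm. 6.2, §8] -/
theorem stub_shadowDescent :
    ∀ (W : WeierstrassCurve ℚ) [W.IsElliptic] [W.IsGloballyMinimal], ¬ W.HasCM → W.analyticRank = 0 →
      GoodSS W 2 → W.frobeniusTrace 2 = 0 → W.Δ < 0 →
      ∀ (κ : ZpExtension ℚ 2) (γ : Field.absoluteGaloisGroup ℚ), κ.IsCyclotomic → κ.IsTopGenerator γ →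
      (∀ (D : SignedSelmerDualData W κ γ 1) [Module.Finite (IwasawaAlgebra 2) D.X],
        Nat.card (D.X ⧸ (IsLocalRing.maximalIdeal (IwasawaAlgebra 2)) • (⊤ : Submodule (IwasawaAlgebra 2) D.X)) ≤
          Nat.card (W.selmerGroup 2) * 4 ^ (W.conductorNorm ℤ).primeFactors.card) →
      (∃ D : SignedSelmerDualData W κ γ 1, Module.Finite (IwasawaAlgebra 2) D.X) →
      {s : signedSelmerInfty W κ 1 | 2 • s = 0}.Finite := by
  sorry

/-- **The crux BY NAME from the two stubs, with `A := W`** (identity on `W[2]`), through the tree door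
`SignedMuAtTwo.signedMuSeedAtTwoPlus_of_sel2Seed` (finiteness of `Sel⁺(A/ℚ_∞)[2]` ⇒ torsion ∧ `μ = 0`, B. D. Kim /
Greenberg–Vatsal reading).  No member search, no Euler system, no `p`-adic `L`-function, no class group.
BSD is not proved by this. [cite: GreenbergVatsal2000, p. 3] [cite: BDKim2009, Prop. 2.10, Cor. 2.13] -/
theorem SignedMuSeedAtTwoPlus_of
    (hP : ∀ (W : WeierstrassCurve ℚ) [W.IsElliptic] [W.IsGloballyMinimal], ¬ W.HasCM → W.analyticRank = 0 →
      GoodSS W 2 → W.frobeniusTrace 2 = 0 → W.Δ < 0 →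
      ∀ (κ : ZpExtension ℚ 2) (γ : Field.absoluteGaloisGroup ℚ), κ.IsCyclotomic → κ.IsTopGenerator γ →
      ∀ (D : SignedSelmerDualData W κ γ 1) [Module.Finite (IwasawaAlgebra 2) D.X],
        Nat.card (D.X ⧸ (IsLocalRing.maximalIdeal (IwasawaAlgebra 2)) • (⊤ : Submodule (IwasawaAlgebra 2) D.X)) ≤
          Nat.card (W.selmerGroup 2) * 4 ^ (W.conductorNorm ℤ).primeFactors.card)
    (hS : ∀ (W : WeierstrassCurve ℚ) [W.IsElliptic] [W.IsGloballyMinimal], ¬ W.HasCM → W.analyticRank = 0 →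
      GoodSS W 2 → W.frobeniusTrace 2 = 0 → W.Δ < 0 →
      ∀ (κ : ZpExtension ℚ 2) (γ : Field.absoluteGaloisGroup ℚ), κ.IsCyclotomic → κ.IsTopGenerator γ →
      (∀ (D : SignedSelmerDualData W κ γ 1) [Module.Finite (IwasawaAlgebra 2) D.X],
        Nat.card (D.X ⧸ (IsLocalRing.maximalIdeal (IwasawaAlgebra 2)) • (⊤ : Submodule (IwasawaAlgebra 2) D.X)) ≤
          Nat.card (W.selmerGroup 2) * 4 ^ (W.conductorNorm ℤ).primeFactors.card) →
      (∃ D : SignedSelmerDualData W κ γ 1, Module.Finite (IwasawaAlgebra 2) D.X) →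
      {s : signedSelmerInfty W κ 1 | 2 • s = 0}.Finite) :
    SignedMuSeedAtTwoPlus := by
  refine Theorems.SignedMuAtTwo.signedMuSeedAtTwoPlus_of_sel2Seed fun W _ _ hCM hr hss ha hΔ ↦ ?_
  exact ⟨W, inferInstance, inferInstance, hss, ha, ⟨AddEquiv.refl _, fun _ _ ↦ rfl⟩,
    fun κ γ hκ hγ hD ↦ hS W hCM hr hss ha hΔ κ γ hκ hγ
      (fun D _ ↦ hP W hCM hr hss ha hΔ κ γ hκ hγ D) hD⟩

/-- Instantiated at the stubs: the crux `SignedMuSeedAtTwoPlus` BY NAME (sorries only inside `stub_*`). -/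
theorem SignedMuSeedAtTwoPlus_of_stubs : SignedMuSeedAtTwoPlus :=
  SignedMuSeedAtTwoPlus_of stub_fixedPointPresentation stub_shadowDescent

end Summit.BirchSwinnertonDyer.BirchSwinnertonDyer.Cruxes.SignedMuSeedAtTwoPlus.ShadowDescent

end
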